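import Summits.QuantumAdvantage.QuantumAdvantage.Theorems.InnerDegreeLawsJ

set_option linter.dupNamespace false

/-!
# LIVENESS SEPARATION, part K (lens 4, g28 cycle 4c) — the `t`-LABEL family pattern has full row rank (Lemma N5 in `t` variables)

Blocker `X = AbsorptionDial.NoPerfectPolyOdd` (item 28487); rungs «`t` quadratic registers, `t` constant» of the t-ladder (NODE-g28 §5f).  After the
class normal form (part J) the exceptional register reads `t′ ≤ t` quadratic labels; on a rectangle with cube rows `1_S` and a jointly saturated
column family its live firing pattern is the `t`-LABEL FAMILY PATTERN `[H_i(j ↦ ⟨(1,a_i), w_j⟩)]_{i ∈ ι, w ∈ (𝔽_p^{r+1})^t}`, `a` injective,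
`H_i : 𝔽_p^t → K` non-constant.  Kernel-checked here (characteristic-two `K ∋ μ_p`, `p ≥ 5`; over the tree's `charMat` / `lineRep` / `negMat`):

* `fourier_invT`, `exists_fcoefT_ne_zero` — Fourier inversion on `𝔽_p^t`, read off the tree's matrix identity `F·F = N` (`charMat_mul_charMat`),
  and a nonzero coefficient at a nonzero frequency VECTOR for every non-constant `H`;
* `charMatT` = the character matrix of `(𝔽_p^{r})^t`, realised as the reindexing of `charMat hω (t·r)` along the flattening `flatEquiv`
  (`charMatT_apply`, `isUnit_charMatT_det` by `Matrix.det_submatrix_equiv_self`);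
* `famMatT_mul_charMatT` (`P_t = M_t · F_t`), `famMatT_submatrix` (DIAGONAL on the columns `j ↦ s_i(j)•ℓ_i`, `s_i ≠ 0`: frequency vectors of two
  distinct affine points `(1,a_i)` meet only at `0`), ★ `rank_famPatT_ge` (rank `≥ |ι|`), `rank_famPatT_flat_ge` (a product of `t` affine
  reparametrisations of the labels);
* ★ `loss_of_tLabelRectangle` — the game corollary: registers `k`-form except `g₀`, `g₀` live on a disjoint-support rectangle whose columns are indexed
  by ALL `w ∈ (𝔽_p^{r+1})^t` and firing there as `G_i(j ↦ ⟨(1,a_i), N_j w_j + w₀_j⟩)`, row-dependent non-constant `G_i : 𝔽_p^t → Bool`,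
  `|ι| > (n+1)·2p^k + 1` ⇒ a losing input (tree `loss_of_rectRank`).  `t = 1` is the tree's `loss_of_columnSaturatedRectangle`, `t = 2` is part H.
-/

open Finset
open Summit.QuantumAdvantage.AdviceFreeQNC0
open Summit.QuantumAdvantage.QuantumAdvantage.Theorems.InnerDegreeDial

namespace Summit.QuantumAdvantage.QuantumAdvantage.Theorems.LivenessSeparation

/-! ### flattening `(Fin t → Fin r → R) ≃ (Fin (t·r) → R)` -/

/-- flatten a `t`-tuple of `r`-vectors into one `(t·r)`-vector -/
def flatT {R : Type*} (t r : ℕ) (u : Fin t → Fin r → R) : Fin (t * r) → R :=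
  fun l => u (finProdFinEquiv.symm l).1 (finProdFinEquiv.symm l).2

/-- the flattening is a bijection -/
def flatEquiv (R : Type*) (t r : ℕ) : (Fin t → Fin r → R) ≃ (Fin (t * r) → R) where
  toFun := flatT t r
  invFun U j i := U (finProdFinEquiv (j, i))
  left_inv u := by
    funext j i
    simp [flatT]
  right_inv U := by
    funext l
    simp only [flatT, Prod.mk.eta, Equiv.apply_symm_apply]

/-- flattening turns the sum of the `t` dot products into one dot product -/
theorem flatT_dotProduct {R : Type*} [CommSemiring R] (t r : ℕ) (u w : Fin t → Fin r → R) :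
    flatT t r u ⬝ᵥ flatT t r w = ∑ j, u j ⬝ᵥ w j := by
  unfold flatT dotProduct
  rw [Fintype.sum_equiv finProdFinEquiv.symm
    (fun l => u (finProdFinEquiv.symm l).1 (finProdFinEquiv.symm l).2 * w (finProdFinEquiv.symm l).1 (finProdFinEquiv.symm l).2)
    (fun q => u q.1 q.2 * w q.1 q.2) (fun l => rfl), Fintype.sum_prod_type]

section TLabel

variable {K : Type*} [Field K] [CharP K 2]
variable {p : ℕ} [Fact p.Prime]

/-! ### Fourier inversion on `𝔽_p^t` -/

/-- `t`-variable Fourier coefficient `Ĥ(s) = Σ_x H(x) ψ(⟨−x, s⟩)` -/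
noncomputable def fcoefT {ω : K} (hω : IsPrimitiveRoot ω p) {t : ℕ} (H : (Fin t → ZMod p) → K) (s : Fin t → ZMod p) : K :=
  ∑ x, H x * Coset21.CharTwoKill.chi ω hω ((-x) ⬝ᵥ s)

/-- Fourier inversion on `𝔽_p^t` in characteristic two (from the tree's `F·F = N`) -/
theorem fourier_invT (hp5 : 5 ≤ p) {ω : K} (hω : IsPrimitiveRoot ω p) {t : ℕ} (H : (Fin t → ZMod p) → K) (z : Fin t → ZMod p) :
    ∑ s, fcoefT hω H s * Coset21.CharTwoKill.chi ω hω (s ⬝ᵥ z) = H z := by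
  classical
  have key : ∀ x : Fin t → ZMod p,
      ∑ s, Coset21.CharTwoKill.chi ω hω ((-x) ⬝ᵥ s) * Coset21.CharTwoKill.chi ω hω (s ⬝ᵥ z) = if z = x then (1 : K) else 0 := by
    intro x
    have h := congrFun (congrFun (charMat_mul_charMat hp5 hω t) (-x)) z
    rw [Matrix.mul_apply] at h
    simpa only [charMat, negMat, Matrix.of_apply, neg_neg] using h
  calc ∑ s, fcoefT hω H s * Coset21.CharTwoKill.chi ω hω (s ⬝ᵥ z)
      = ∑ s, ∑ x, H x * (Coset21.CharTwoKill.chi ω hω ((-x) ⬝ᵥ s) * Coset21.CharTwoKill.chi ω hω (s ⬝ᵥ z)) := by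
        refine sum_congr rfl fun s _ => ?_
        rw [fcoefT, sum_mul]
        refine sum_congr rfl fun x _ => ?_
        rw [mul_assoc]
    _ = ∑ x, H x * ∑ s, Coset21.CharTwoKill.chi ω hω ((-x) ⬝ᵥ s) * Coset21.CharTwoKill.chi ω hω (s ⬝ᵥ z) := by
        rw [sum_comm]
        refine sum_congr rfl fun x _ => ?_
        rw [mul_sum]
    _ = ∑ x, H x * (if z = x then (1 : K) else 0) := by
        refine sum_congr rfl fun x _ => ?_
        rw [key]
    _ = H z := by
        simp_rw [mul_ite, mul_one, mul_zero]
        rw [sum_ite_eq]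
        simp

/-- a non-constant `H : 𝔽_p^t → K` has a nonzero Fourier coefficient at a nonzero frequency vector -/
theorem exists_fcoefT_ne_zero (hp5 : 5 ≤ p) {ω : K} (hω : IsPrimitiveRoot ω p) {t : ℕ} (H : (Fin t → ZMod p) → K)
    {a b : Fin t → ZMod p} (hab : H a ≠ H b) : ∃ s, s ≠ 0 ∧ fcoefT hω H s ≠ 0 := by
  classical
  by_contra h
  have h' : ∀ s, s ≠ 0 → fcoefT hω H s = 0 := fun s hs =>
    Classical.byContradiction fun hne => h ⟨s, hs, hne⟩
  have hconst : ∀ z, H z = fcoefT hω H 0 := by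
    intro z
    rw [← fourier_invT hp5 hω H z, sum_eq_single (0 : Fin t → ZMod p)]
    · rw [zero_dotProduct, AddChar.map_zero_eq_one, mul_one]
    · intro s _ hs
      rw [h' s hs, zero_mul]
    · intro h0
      exact absurd (mem_univ _) h0
  exact hab (by rw [hconst a, hconst b])

/-! ### the character matrix of `(𝔽_p^r)^t` and the factorisation `P_t = M_t · F_t` -/

/-- the character matrix `F_t[u,w] = ψ(Σ_j ⟨u_j, w_j⟩)` of `(𝔽_p^r)^t`, as the reindexed character matrix of `𝔽_p^{t·r}` -/
noncomputable def charMatT {ω : K} (hω : IsPrimitiveRoot ω p) (t r : ℕ) :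
    Matrix (Fin t → Fin r → ZMod p) (Fin t → Fin r → ZMod p) K :=
  (charMat hω (t * r)).submatrix (flatEquiv (ZMod p) t r) (flatEquiv (ZMod p) t r)

omit [CharP K 2] in
/-- its entries -/
theorem charMatT_apply {ω : K} (hω : IsPrimitiveRoot ω p) (t r : ℕ) (u w : Fin t → Fin r → ZMod p) :
    charMatT hω t r u w = Coset21.CharTwoKill.chi ω hω (∑ j, u j ⬝ᵥ w j) := by
  rw [charMatT, Matrix.submatrix_apply, charMat, Matrix.of_apply]
  exact congrArg _ (flatT_dotProduct t r u w)

/-- `F_t` is invertible -/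
theorem isUnit_charMatT_det (hp5 : 5 ≤ p) {ω : K} (hω : IsPrimitiveRoot ω p) (t r : ℕ) : IsUnit (charMatT hω t r).det := by
  classical
  rw [charMatT, Matrix.det_submatrix_equiv_self]
  exact isUnit_charMat_det hp5 hω (t * r)

/-- `t`-LABEL pattern of a row family against ALL column tuples: `[H_i(j ↦ ⟨(1,a_i), w_j⟩)]_{i, w}` -/
def famPatT {r t : ℕ} {ι : Type*} (a : ι → Fin r → ZMod p) (H : ι → (Fin t → ZMod p) → K) :
    Matrix ι (Fin t → Fin (r + 1) → ZMod p) K :=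
  Matrix.of fun i w => H i fun j => lineRep p r (a i) ⬝ᵥ w j

/-- `t`-label line-block matrix `M_t[i,u] = Σ_{s : (j ↦ s_j•(1,a_i)) = u} Ĥ_i(s)` -/
noncomputable def famMatT {ω : K} (hω : IsPrimitiveRoot ω p) {r t : ℕ} {ι : Type*} (a : ι → Fin r → ZMod p)
    (H : ι → (Fin t → ZMod p) → K) : Matrix ι (Fin t → Fin (r + 1) → ZMod p) K :=
  Matrix.of fun i u => ∑ s : Fin t → ZMod p, if (fun j => s j • lineRep p r (a i)) = u then fcoefT hω (H i) s else 0

/-- `P_t = M_t · F_t` (Fourier inversion on `𝔽_p^t`, row by row) -/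
theorem famMatT_mul_charMatT (hp5 : 5 ≤ p) {ω : K} (hω : IsPrimitiveRoot ω p) {r t : ℕ} {ι : Type*}
    (a : ι → Fin r → ZMod p) (H : ι → (Fin t → ZMod p) → K) :
    famMatT hω a H * charMatT hω t (r + 1) = famPatT a H := by
  classical
  ext i w
  rw [Matrix.mul_apply, famPatT, Matrix.of_apply]
  have h1 : ∀ u, famMatT hω a H i u * charMatT hω t (r + 1) u w
      = ∑ s : Fin t → ZMod p, if (fun j => s j • lineRep p r (a i)) = u then
          fcoefT hω (H i) s * Coset21.CharTwoKill.chi ω hω (∑ j, u j ⬝ᵥ w j) else 0 := by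
    intro u
    rw [famMatT, Matrix.of_apply, charMatT_apply, sum_mul]
    refine sum_congr rfl fun s _ => ?_
    split_ifs
    · rfl
    · rw [zero_mul]
  simp_rw [h1]
  rw [sum_comm]
  have h2 : ∀ s : Fin t → ZMod p, ∑ u : Fin t → Fin (r + 1) → ZMod p,
      (if (fun j => s j • lineRep p r (a i)) = u then
          fcoefT hω (H i) s * Coset21.CharTwoKill.chi ω hω (∑ j, u j ⬝ᵥ w j) else 0)
      = fcoefT hω (H i) s * Coset21.CharTwoKill.chi ω hω (s ⬝ᵥ fun j => lineRep p r (a i) ⬝ᵥ w j) := by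
    intro s
    rw [sum_ite_eq]
    simp only [mem_univ, if_true, smul_dotProduct, smul_eq_mul]
    rfl
  simp_rw [h2]
  exact fourier_invT hp5 hω (H i) fun j => lineRep p r (a i) ⬝ᵥ w j

omit [CharP K 2] in
/-- rows `i`, columns `j ↦ s_i(j)•(1,a_i)` with one frequency vector `s_i ≠ 0` per row: the `t`-label line-block matrix is DIAGONAL — the
frequency vectors of two distinct affine points `(1,a_i)`, `(1,a_{i'})` meet only at `0` -/
theorem famMatT_submatrix {ω : K} (hω : IsPrimitiveRoot ω p) {r t : ℕ} {ι : Type*} [DecidableEq ι] (a : ι → Fin r → ZMod p)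
    (ha : Function.Injective a) (H : ι → (Fin t → ZMod p) → K) (s : ι → Fin t → ZMod p) (hs : ∀ i, s i ≠ 0) :
    (famMatT hω a H).submatrix (fun i => i) (fun i => fun j => s i j • lineRep p r (a i))
      = Matrix.diagonal fun i => fcoefT hω (H i) (s i) := by
  classical
  have hfst : ∀ i i' (s' s₀ : ZMod p), s' • lineRep p r (a i) = s₀ • lineRep p r (a i') → s' = s₀ := by
    intro i i' s' s₀ h
    have := congrFun h 0
    simpa [lineRep] using this
  have hline : ∀ i i' (s₀ : ZMod p), s₀ ≠ 0 → s₀ • lineRep p r (a i) = s₀ • lineRep p r (a i') → i = i' := by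
    intro i i' s₀ hs₀ h
    have hinj : lineRep p r (a i) = lineRep p r (a i') := smul_right_injective _ hs₀ h
    apply ha
    funext j
    have := congrFun hinj j.succ
    simpa [lineRep] using this
  ext i i'
  rw [Matrix.submatrix_apply, famMatT, Matrix.of_apply, Matrix.diagonal_apply]
  by_cases h : i = i'
  · subst h
    rw [if_pos rfl, Fintype.sum_eq_single (s i)]
    · rw [if_pos rfl]
    · intro s' hs'
      rw [if_neg]
      intro heq
      apply hs'
      funext j
      exact hfst i i (s' j) (s i j) (congrFun heq j)
  · rw [if_neg h]
    refine sum_eq_zero fun s' _ => ?_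
    rw [if_neg]
    intro heq
    obtain ⟨j₀, hj₀⟩ := Function.ne_iff.mp (hs i')
    have h1 : s' j₀ • lineRep p r (a i) = s i' j₀ • lineRep p r (a i') := congrFun heq j₀
    rw [hfst i i' (s' j₀) (s i' j₀) h1] at h1
    exact h (hline i i' (s i' j₀) hj₀ h1)

/-- **LEMMA N5 in `t` variables: `t`-LABEL ONE-SIDED SATURATION.**  Rows: any injective family of affine points `(1,a_i)`, `a : ι → 𝔽_p^r`
injective, with row-dependent NON-CONSTANT tables `H_i : 𝔽_p^t → K`; columns: ALL tuples `w ∈ (𝔽_p^{r+1})^t`.  Then `[H_i(j ↦ ⟨(1,a_i), w_j⟩)]_{i,w}`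
has rank `≥ |ι|` over every characteristic-two `K ∋ μ_p`. -/
theorem rank_famPatT_ge (hp5 : 5 ≤ p) {ω : K} (hω : IsPrimitiveRoot ω p) {r t : ℕ} {ι : Type*} [Fintype ι]
    (a : ι → Fin r → ZMod p) (ha : Function.Injective a) (H : ι → (Fin t → ZMod p) → K) (hH : ∀ i, ∃ x x', H i x ≠ H i x') :
    Fintype.card ι ≤ (famPatT a H).rank := by
  classical
  have hch : ∀ i, ∃ s₀ : Fin t → ZMod p, s₀ ≠ 0 ∧ fcoefT hω (H i) s₀ ≠ 0 := fun i => by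
    obtain ⟨x, x', hxx'⟩ := hH i
    exact exists_fcoefT_ne_zero hp5 hω _ hxx'
  choose s hs0 hsc using hch
  rw [← famMatT_mul_charMatT hp5 hω a H,
    Matrix.rank_mul_eq_left_of_isUnit_det _ _ (isUnit_charMatT_det hp5 hω t (r + 1))]
  refine le_trans ?_ (Matrix.rank_submatrix_le (famMatT hω a H) (fun i => i) (fun i => fun j => s i j • lineRep p r (a i)))
  rw [famMatT_submatrix hω a ha H s hs0]
  have hu : IsUnit (Matrix.diagonal fun i => fcoefT hω (H i) (s i)) := by
    rw [Matrix.isUnit_iff_isUnit_det, Matrix.det_diagonal]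
    exact isUnit_iff_ne_zero.mpr (prod_ne_zero_iff.mpr fun i _ => hsc i)
  rw [Matrix.rank_of_isUnit _ hu]

/-- the same through a product of `t` affine reparametrisations `w_j ↦ N_j w_j + w₀_j` (`N_j * N'_j = 1`) of the labels -/
theorem rank_famPatT_flat_ge (hp5 : 5 ≤ p) {ω : K} (hω : IsPrimitiveRoot ω p) {r t : ℕ} {ι : Type*} [Fintype ι]
    (a : ι → Fin r → ZMod p) (ha : Function.Injective a) (H : ι → (Fin t → ZMod p) → K) (hH : ∀ i, ∃ x x', H i x ≠ H i x')
    (w₀ : Fin t → Fin (r + 1) → ZMod p) (N N' : Fin t → Matrix (Fin (r + 1)) (Fin (r + 1)) (ZMod p)) (hN : ∀ j, N j * N' j = 1) :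
    Fintype.card ι ≤ (Matrix.of fun i (w : Fin t → Fin (r + 1) → ZMod p) =>
      H i fun j => lineRep p r (a i) ⬝ᵥ ((N j).mulVec (w j) + w₀ j)).rank := by
  classical
  have hsub : (Matrix.of fun i (w : Fin t → Fin (r + 1) → ZMod p) =>
      H i fun j => lineRep p r (a i) ⬝ᵥ ((N j).mulVec (w j) + w₀ j)).submatrix
      (fun i => i) (fun w => fun j => (N' j).mulVec (w j - w₀ j))
      = famPatT a H := by
    ext i w
    simp only [Matrix.submatrix_apply, Matrix.of_apply, famPatT, Matrix.mulVec_mulVec, hN, Matrix.one_mulVec, sub_add_cancel]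
  have h1 := rank_famPatT_ge hp5 hω a ha H hH
  rw [← hsub] at h1
  exact h1.trans (Matrix.rank_submatrix_le _ _ _)

variable {n : ℕ}

/-- **THE `t`-LABEL RECTANGLE KILL.**  Registers `k`-form except `g₀`; rows ANY family `X i`, columns `Y w` indexed by ALL tuples
`w ∈ (𝔽_p^{r+1})^t` (a column family whose `t` labelled cross-statistics are JOINTLY saturated), disjoint supports, `g₀` live on the rectangle and firing
there as `G_i(j ↦ ⟨(1,a_i), N_j w_j + w₀_j⟩)` for an injective `a : ι → 𝔽_p^r` and ROW-DEPENDENT non-constant tables `G_i : 𝔽_p^t → Bool`;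
`|ι| > (n+1)·2p^k + 1` forces a losing input (tree `loss_of_rectRank` + `rank_famPatT_flat_ge` over `𝔽₂(μ_{3p})`). -/
theorem loss_of_tLabelRectangle (hp5 : 5 ≤ p) {k r t : ℕ} {ι : Type*} [Fintype ι] (c : ℕ)
    (y : Fin (n + 1) → (Fin n → Bool) → Bool) (g₀ : Fin (n + 1))
    (lam : Fin (n + 1) → Fin k → Fin n → ZMod p) (F : Fin (n + 1) → (Fin k → ZMod p) → Bool)
    (hF : ∀ g, g ≠ g₀ → ∀ u, y g u = F g (fun j => ∑ i, if u i = true then lam g j i else 0))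
    (X : ι → Fin n → Bool) (Y : (Fin t → Fin (r + 1) → ZMod p) → Fin n → Bool)
    (hd : ∀ i w l, ¬ (X i l = true ∧ Y w l = true))
    (G : ι → (Fin t → ZMod p) → Bool) (hG : ∀ i, ∃ b b', G i b ≠ G i b')
    (a : ι → Fin r → ZMod p) (ha : Function.Injective a) (w₀ : Fin t → Fin (r + 1) → ZMod p)
    (N N' : Fin t → Matrix (Fin (r + 1)) (Fin (r + 1)) (ZMod p)) (hN : ∀ j, N j * N' j = 1)
    (hpat : ∀ i w, y g₀ (bor (X i) (Y w)) = G i fun j => lineRep p r (a i) ⬝ᵥ ((N j).mulVec (w j) + w₀ j))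
    (hlive : ∀ i w, liveCut c (bor (X i) (Y w)) g₀ = true)
    (ht : (n + 1) * (p ^ k * 2) + 1 < Fintype.card ι) :
    ∃ u, ringWinU c y u = false := by
  classical
  obtain ⟨hK, ω, -, hω, -⟩ := Coset21.exists_charTwo_roots p hp5
  haveI := hK
  refine loss_of_rectRank hp5 c y g₀ lam F hF X Y hd (lt_of_lt_of_le ht ?_)
  have hrect : rect (Kp p) (fun u => y g₀ u && liveCut c u g₀) X Y
      = Matrix.of fun i (w : Fin t → Fin (r + 1) → ZMod p) =>
          (fun i z => if G i z = true then (1 : Kp p) else 0) i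
            fun j => lineRep p r (a i) ⬝ᵥ ((N j).mulVec (w j) + w₀ j) := by
    ext i w
    rw [rect, Matrix.of_apply, Matrix.of_apply]
    simp only [hpat i w, hlive i w, Bool.and_true]
  rw [hrect]
  refine rank_famPatT_flat_ge hp5 hω a ha (fun i z => if G i z = true then (1 : Kp p) else 0) ?_ w₀ N N' hN
  intro i
  obtain ⟨b, b', hb⟩ := hG i
  refine ⟨b, b', ?_⟩
  intro h
  apply hb
  cases h1 : G i b <;> cases h2 : G i b' <;> simp_all

end TLabel

end Summit.QuantumAdvantage.QuantumAdvantage.Theorems.LivenessSeparation
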